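import Summits.CriticalPhenomena.SAWScalingLimit.Theorems.SAWRenewalTightnessTubeLowerBoundKestenTiltCuts
import Summits.CriticalPhenomena.SAWScalingLimit.Theorems.SAWRenewalTightnessStripMassConservation
import Literature.Probability.RandomPlanarGeometry.SAWSusceptibility

/-!
# Stub S1 `stub_kestenTilt` of the line `subcritical-renewal-floor` (crux `TubeLowerBound`,
stmt-CriticalPhenomena-4730), part II: three renewal inequalities for the truncated generating functions

Support file for `SAWRenewalTightnessTubeLowerBoundKestenTilt.lean` (exactly tilted Kesten pairs below
`x_c`, Madras–Slade 1993, §4.2), continuing `…KestenTiltCuts.lean`, whose module docstring fixes the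
conventions: the truncated generating functions `Φ_N(z, m)` (irreducible bridges, tilted), `B_N(z, m)`
(bridges, tilted), `B_N^{≥ L}(z, m)` (bridges of span `≥ L`), `H_N(z, L)` (half-space words ending on `x = L`,
untilted), `χ_N(z)` (all words) over the self-avoiding words of length `≤ N` are written out as explicit
finite sums (lemma prefixes `gfIrr`, `gfBr`, `gfBrGe`, `gfPos`, `gfAll`):

* `gfAll_bounded` — `χ_N(z) ≤ C(z)` uniformly in `N` for `0 < z < x_c` (radius of convergence of the
  susceptibility, `Zd.exists_bound_count_mul_pow`);
* `gfBr_le`, `gfBr_le_of_lt_one` — the TILTED RENEWAL INEQUALITY `B_N ≤ 1 + Φ_N B_N`, hence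
  `B_N ≤ 1/(1 - Φ̄)` when `Φ_N ≤ Φ̄ < 1` (Madras–Slade (4.2.2)–(4.2.3), tilted; first irreducible factor
  `StripMass.exists_irrBridge_append`);
* `gfBrGe_le`, `gfBr_le_of_gfPos_le` — RENEWAL AT SCALE `L₀`: `B_N^{≥ L₀} ≤ H_N(z, L₀) e^{mL₀} B_N`
  (last-exit cut), so `H_N(z, L₀) e^{mL₀} ≤ 1/2` forces `B_N(z, m) ≤ 2 L₀ e^{mL₀}` for `0 ≤ z ≤ x_c` (the
  spans `< L₀` have critical mass `≤ 1` each, `StripMass.bridgeWordMass_le_one`);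
* `gfPos_mul_exp_le` — `H_N(z, L) e^{mL} ≤ B_N^{≥ L}(z, m) χ_N(z)` (cut at a maximum);
* `exists_gfBrGe_le` — if `B_N(z, m)` is bounded in `N`, its span tails `B_N^{≥ L₀}` are uniformly small.

References: N. Madras, G. Slade, *The Self-Avoiding Walk* (1993), §1.3 (1.3.6), §4.1 (4.1.12)–(4.1.20),
§4.2 (4.2.1)–(4.2.3).
-/

noncomputable section

namespace Summit.CriticalPhenomena.SAWScalingLimit.Theorems.TubeLowerBound.SubcriticalRenewalFloor

open scoped BigOperators Classical
open Literature.Probability.LatticeModels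
open Literature.Probability.RandomPlanarGeometry Literature.Probability.RandomPlanarGeometry.SAW

namespace KestenTilt

open Finset Filter Topology

/-! ### The truncated susceptibility is bounded below `x_c` -/

/-- `χ_N(z) = Σ_{n ≤ N} cₙ zⁿ` (`#sawWords n = cₙ`). [cite: MadrasSlade1993, §1.1] -/
theorem gfAll_eq (N : ℕ) (z : ℝ) :
    (∑ w ∈ ((Finset.range (N + 1)).biUnion sawWords), z ^ w.length) = ∑ n ∈ Finset.range (N + 1),
        (Zd.count 2 n : ℝ) * z ^ n := by
  rw [Finset.sum_biUnion]
  · refine Finset.sum_congr rfl fun n _ => ?_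
    rw [Finset.sum_congr rfl (g := fun _ => z ^ n) fun w hw => by rw [(mem_sawWords.1 hw).1],
      Finset.sum_const, nsmul_eq_mul, card_sawWords]
  · intro n _ n' _ hne
    simp only [Function.onFun]
    rw [Finset.disjoint_left]
    intro w hw hw'
    exact hne ((mem_sawWords.1 hw).1.symm.trans (mem_sawWords.1 hw').1)

/-- **`χ_N(z) ≤ C(z) < ∞` uniformly in `N` for `0 < z < x_c`**: `cₙ zⁿ` decays geometrically below the
radius of convergence `z_c = x_c` of the susceptibility (`Zd.exists_bound_count_mul_pow` at the midpoint
`(z + x_c)/2`). [cite: MadrasSlade1993, §1.3, (1.3.6)] -/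
theorem gfAll_bounded {z : ℝ} (hz : 0 < z) (hzc : z < criticalFugacity) :
    ∃ C : ℝ, 0 < C ∧ ∀ N, (∑ w ∈ ((Finset.range (N + 1)).biUnion sawWords), z ^ w.length) ≤ C := by
  set z₂ := (z + criticalFugacity) / 2 with hz₂
  have h1 : z < z₂ := by rw [hz₂]; linarith
  have h2 : z₂ < criticalFugacity := by rw [hz₂]; linarith
  have h0 : 0 < z₂ := hz.trans h1
  obtain ⟨K, hK⟩ := Zd.exists_bound_count_mul_pow (d := 2) h0 (by rwa [Zd.criticalPoint_two])
  have hK0 : 0 ≤ K := le_trans (by positivity) (hK 0)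
  set r := z / z₂ with hr
  have hr0 : 0 ≤ r := by positivity
  have hr1 : r < 1 := (div_lt_one h0).2 h1
  have hKr : 0 ≤ K / (1 - r) := div_nonneg hK0 (sub_pos.2 hr1).le
  refine ⟨K / (1 - r) + 1, by linarith, fun N => ?_⟩
  rw [gfAll_eq]
  have hterm : ∀ n, (Zd.count 2 n : ℝ) * z ^ n ≤ K * r ^ n := fun n => by
    have hzr : z = z₂ * r := by rw [hr]; field_simp
    calc (Zd.count 2 n : ℝ) * z ^ n = (Zd.count 2 n : ℝ) * z₂ ^ n * r ^ n := by
          rw [hzr, mul_pow, mul_assoc]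
      _ ≤ K * r ^ n := mul_le_mul_of_nonneg_right (hK n) (pow_nonneg hr0 n)
  calc ∑ n ∈ Finset.range (N + 1), (Zd.count 2 n : ℝ) * z ^ n
      ≤ ∑ n ∈ Finset.range (N + 1), K * r ^ n := Finset.sum_le_sum fun n _ => hterm n
    _ = K * ∑ n ∈ Finset.range (N + 1), r ^ n := by rw [Finset.mul_sum]
    _ ≤ K * (1 / (1 - r)) := by
        refine mul_le_mul_of_nonneg_left ?_ hK0
        have := geom_sum_Ico_le_of_lt_one (m := 0) (n := N + 1) hr0 hr1
        rwa [pow_zero, ← Finset.range_eq_Ico] at this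
    _ ≤ K / (1 - r) + 1 := by rw [mul_one_div]; linarith

/-! ### Step 1: the tilted renewal inequality -/

/-- **Tilted renewal inequality** `B_N ≤ 1 + Φ_N · B_N` (`z ≥ 0`): the empty word contributes `1`, and a
non-empty bridge word is `s ++ t` with `s` irreducible and `t` a bridge word, both of length `≤ N`,
injectively, the tilted weight being multiplicative. [cite: MadrasSlade1993, §4.2, (4.2.2)–(4.2.3)] -/
theorem gfBr_le {z m : ℝ} (hz : 0 ≤ z) (N : ℕ) :
    (∑ w ∈ ((Finset.range (N + 1)).biUnion sawWords).filter (fun w => IsBridgeW w),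
    z ^ w.length * Real.exp (m * (xEnd w : ℝ))) ≤ 1
    + (∑ w ∈ ((Finset.range (N + 1)).biUnion sawWords).filter (fun w => IsIrrBridge w),
    z ^ w.length * Real.exp (m * (xEnd w : ℝ)))
    * (∑ w ∈ ((Finset.range (N + 1)).biUnion sawWords).filter (fun w => IsBridgeW w),
    z ^ w.length * Real.exp (m * (xEnd w : ℝ))) := by
  have hnil : ([] : List Step) ∈ ((Finset.range (N + 1)).biUnion sawWords).filter
      (fun w => IsBridgeW w) :=
    Finset.mem_filter.2 ⟨mem_Wset.2 ⟨by simp, isSAW_nil⟩, isBridgeW_nil⟩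
  have hsplit : (∑ w ∈ ((Finset.range (N + 1)).biUnion sawWords).filter (fun w => IsBridgeW w),
      z ^ w.length * Real.exp (m * (xEnd w : ℝ))) =
      1 + ∑ w ∈ (((Finset.range (N + 1)).biUnion sawWords).filter (fun w => IsBridgeW w)).erase [],
          (z ^ w.length * Real.exp (m * (xEnd w : ℝ))) := by
    rw [← Finset.add_sum_erase _ _ hnil, tiltWt_nil]
  have key : ∑ w ∈ (((Finset.range (N + 1)).biUnion sawWords).filter (fun w => IsBridgeW w)).erase [],
      (z ^ w.length * Real.exp (m * (xEnd w : ℝ))) ≤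
      (∑ w ∈ ((Finset.range (N + 1)).biUnion sawWords).filter (fun w => IsIrrBridge w),
          z ^ w.length * Real.exp (m * (xEnd w : ℝ)))
          * (∑ w ∈ ((Finset.range (N + 1)).biUnion sawWords).filter (fun w => IsBridgeW w),
          z ^ w.length * Real.exp (m * (xEnd w : ℝ))) := by
    refine sum_le_mul_sum_of_split (fun p _ => tiltWt_nonneg hz m p)
        (fun q _ => tiltWt_nonneg hz m q)
      ?_
    intro u hu
    obtain ⟨hne, hu'⟩ := Finset.mem_erase.1 hu
    obtain ⟨hW, hb⟩ := Finset.mem_filter.1 hu'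
    obtain ⟨hlen, hsaw⟩ := mem_Wset.1 hW
    obtain ⟨s, t, rfl, hs, ht⟩ := StripMass.exists_irrBridge_append hsaw hb hne
    rw [List.length_append] at hlen
    refine ⟨s, Finset.mem_filter.2 ⟨mem_Wset.2 ⟨by omega, hs.saw⟩, hs⟩, t,
      Finset.mem_filter.2 ⟨mem_Wset.2 ⟨by omega, ?_⟩, ht⟩, rfl, (tiltWt_append z m s t).le⟩
    have := hsaw.drop s.length
    rwa [List.drop_left] at this
  linarith

/-- `B_N ≤ 1/(1 - Φ̄)` if `Φ_N ≤ Φ̄ < 1`. [cite: MadrasSlade1993, §4.2, (4.2.3)] -/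
theorem gfBr_le_of_lt_one {z m A : ℝ} (hz : 0 ≤ z) (hA : A < 1) (N : ℕ)
    (hΦ : (∑ w ∈ ((Finset.range (N + 1)).biUnion sawWords).filter (fun w => IsIrrBridge w),
    z ^ w.length * Real.exp (m * (xEnd w : ℝ))) ≤ A) :
    (∑ w ∈ ((Finset.range (N + 1)).biUnion sawWords).filter (fun w => IsBridgeW w),
        z ^ w.length * Real.exp (m * (xEnd w : ℝ))) ≤ 1 / (1 - A) := by
  have h := gfBr_le hz N (m := m)
  have hB := gfBr_nonneg hz N m
  have h2 : (∑ w ∈ ((Finset.range (N + 1)).biUnion sawWords).filter (fun w => IsIrrBridge w),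
      z ^ w.length * Real.exp (m * (xEnd w : ℝ)))
      * (∑ w ∈ ((Finset.range (N + 1)).biUnion sawWords).filter (fun w => IsBridgeW w),
      z ^ w.length * Real.exp (m * (xEnd w : ℝ))) ≤ A
      * (∑ w ∈ ((Finset.range (N + 1)).biUnion sawWords).filter (fun w => IsBridgeW w),
      z ^ w.length * Real.exp (m * (xEnd w : ℝ))) := mul_le_mul_of_nonneg_right hΦ hB
  rw [le_div_iff₀ (sub_pos.2 hA)]
  nlinarith

/-! ### Step 2: renewal at scale `L₀` -/

/-- **`B_N^{≥ L₀} ≤ H_N(z, L₀) e^{m L₀} · B_N`**: cut a bridge of span `≥ L₀` at its last visit to the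
line `x = L₀` (`exists_pos_append_bridge`). [cite: MadrasSlade1993, §4.1, (4.1.12)–(4.1.13)] -/
theorem gfBrGe_le {z m : ℝ} (hz : 0 ≤ z) (N L₀ : ℕ) :
    (∑ w ∈ ((Finset.range (N + 1)).biUnion sawWords).filter
        (fun w => IsBridgeW w ∧ (L₀ : ℤ) ≤ xEnd w), z ^ w.length * Real.exp (m * (xEnd w : ℝ)))
        ≤ (∑ w ∈ ((Finset.range (N + 1)).biUnion sawWords).filter
        (fun w => (∀ i, 1 ≤ i → i ≤ w.length → 0 < xAt w i) ∧ xEnd w = (L₀ : ℤ)), z ^ w.length) * Real.exp (m * L₀)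
        * (∑ w ∈ ((Finset.range (N + 1)).biUnion sawWords).filter (fun w => IsBridgeW w),
        z ^ w.length * Real.exp (m * (xEnd w : ℝ))) := by
  rw [Finset.sum_mul]
  refine sum_le_mul_sum_of_split (fun p _ => by positivity) (fun q _ => tiltWt_nonneg hz m q) ?_
  intro u hu
  obtain ⟨hW, hb, hL⟩ := Finset.mem_filter.1 hu
  obtain ⟨hlen, hsaw⟩ := mem_Wset.1 hW
  obtain ⟨p, q, rfl, hpos, hpL, hq⟩ := exists_pos_append_bridge hb (Int.natCast_nonneg L₀) hL
  rw [List.length_append] at hlen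
  refine ⟨p, Finset.mem_filter.2 ⟨mem_Wset.2 ⟨by omega, ?_⟩, hpos, hpL⟩, q,
    Finset.mem_filter.2 ⟨mem_Wset.2 ⟨by omega, ?_⟩, hq⟩, rfl, le_of_eq ?_⟩
  · have := hsaw.take p.length
    rwa [List.take_left] at this
  · have := hsaw.drop p.length
    rwa [List.drop_left] at this
  · rw [tiltWt_append, hpL]
    push_cast
    ring

/-- **Scale-`L₀` renewal.** For `0 ≤ z ≤ x_c`, `m ≥ 0`: if `H_N(z, L₀) e^{mL₀} ≤ 1/2` then
`B_N(z, m) ≤ 2 L₀ e^{m L₀}`, because `B_N = B_N^{< L₀} + B_N^{≥ L₀}`, the spans `0 ≤ L < L₀` carry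
`x_c`-mass `≤ 1` each (`StripMass.bridgeWordMass_le_one`) and `B_N^{≥ L₀} ≤ ½ B_N` (`gfBrGe_le`).
[cite: MadrasSlade1993, §4.1, (4.1.12)–(4.1.13)] -/
theorem gfBr_le_of_gfPos_le {z m : ℝ} (hz : 0 ≤ z) (hzc : z ≤ criticalFugacity) (hm : 0 ≤ m)
    {N L₀ : ℕ} (hH : (∑ w ∈ ((Finset.range (N + 1)).biUnion sawWords).filter
        (fun w => (∀ i, 1 ≤ i → i ≤ w.length → 0 < xAt w i) ∧ xEnd w = (L₀ : ℤ)), z ^ w.length) * Real.exp (m * L₀)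
        ≤ 1 / 2) :
    (∑ w ∈ ((Finset.range (N + 1)).biUnion sawWords).filter (fun w => IsBridgeW w),
        z ^ w.length * Real.exp (m * (xEnd w : ℝ))) ≤ 2 * (L₀ * Real.exp (m * L₀)) := by
  have hxc := StripMass.criticalFugacity_pos
  -- `B_N = B_N^{< L₀} + B_N^{≥ L₀}`
  have hsplit : (∑ w ∈ ((Finset.range (N + 1)).biUnion sawWords).filter (fun w => IsBridgeW w),
      z ^ w.length * Real.exp (m * (xEnd w : ℝ)))
      = ∑ w ∈ ((Finset.range (N + 1)).biUnion sawWords).filter (fun w => IsBridgeW w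
      ∧ ¬ ((L₀ : ℤ) ≤ xEnd w)),
      (z ^ w.length * Real.exp (m * (xEnd w : ℝ)))
          + (∑ w ∈ ((Finset.range (N + 1)).biUnion sawWords).filter (fun w => IsBridgeW w
          ∧ (L₀ : ℤ) ≤ xEnd w), z ^ w.length * Real.exp (m * (xEnd w : ℝ))) := by
    rw [← Finset.sum_filter_add_sum_filter_not
        (((Finset.range (N + 1)).biUnion sawWords).filter fun w => IsBridgeW w)
      (fun w => (L₀ : ℤ) ≤ xEnd w), Finset.filter_filter, Finset.filter_filter, add_comm]
  -- the small spans
  have hsmall : ∑ w ∈ ((Finset.range (N + 1)).biUnion sawWords).filter (fun w => IsBridgeW w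
      ∧ ¬ ((L₀ : ℤ) ≤ xEnd w)), (z ^ w.length * Real.exp (m * (xEnd w : ℝ))) ≤
      L₀ * Real.exp (m * L₀) := by
    have hcover : ((Finset.range (N + 1)).biUnion sawWords).filter
        (fun w => IsBridgeW w ∧ ¬ ((L₀ : ℤ) ≤ xEnd w)) ⊆
        (Finset.range L₀).biUnion (fun L => (Finset.range (N + 1)).biUnion
          (fun n => (sawWords n).filter (fun w => IsBridgeW w ∧ xEnd w = (L : ℤ)))) := by
      intro w hw
      obtain ⟨hW, hb, hL⟩ := Finset.mem_filter.1 hw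
      obtain ⟨hlen, hsaw⟩ := mem_Wset.1 hW
      have h0 := hb.xEnd_nonneg
      refine Finset.mem_biUnion.2 ⟨(xEnd w).toNat, Finset.mem_range.2 (by omega),
        StripMass.mem_bridgeWords.2 ⟨hlen, hsaw, hb, by omega⟩⟩
    have hdisj : Set.PairwiseDisjoint (↑(Finset.range L₀) : Set ℕ)
        (fun L => (Finset.range (N + 1)).biUnion
          (fun n => (sawWords n).filter (fun w => IsBridgeW w ∧ xEnd w = (L : ℤ)))) := by
      intro L _ L' _ hne
      simp only [Function.onFun]
      rw [Finset.disjoint_left]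
      intro w hw hw'
      have h1 := (StripMass.mem_bridgeWords.1 hw).2.2.2
      have h2 := (StripMass.mem_bridgeWords.1 hw').2.2.2
      exact hne (by exact_mod_cast h1.symm.trans h2)
    have hterm : ∀ L ∈ Finset.range L₀, ∀ w ∈ (Finset.range (N + 1)).biUnion
        (fun n => (sawWords n).filter (fun w => IsBridgeW w ∧ xEnd w = (L : ℤ))),
        (z ^ w.length * Real.exp (m * (xEnd w : ℝ))) ≤ criticalFugacity ^ w.length
            * Real.exp (m * L₀) := by
      intro L hL w hw
      have hx := (StripMass.mem_bridgeWords.1 hw).2.2.2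
      have hLL : (L : ℝ) ≤ L₀ := by exact_mod_cast (Finset.mem_range.1 hL).le
      refine mul_le_mul (pow_le_pow_left₀ hz hzc _) (Real.exp_le_exp.2 ?_) (Real.exp_nonneg _)
        (pow_nonneg hxc.le _)
      rw [hx]
      push_cast
      exact mul_le_mul_of_nonneg_left hLL hm
    calc ∑ w ∈ ((Finset.range (N + 1)).biUnion sawWords).filter (fun w => IsBridgeW w
        ∧ ¬ ((L₀ : ℤ) ≤ xEnd w)), (z ^ w.length * Real.exp (m * (xEnd w : ℝ)))
        ≤ ∑ w ∈ (Finset.range L₀).biUnion (fun L => (Finset.range (N + 1)).biUnion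
            (fun n => (sawWords n).filter (fun w => IsBridgeW w ∧ xEnd w = (L : ℤ)))),
                (z ^ w.length * Real.exp (m * (xEnd w : ℝ))) :=
          Finset.sum_le_sum_of_subset_of_nonneg hcover fun w _ _ => tiltWt_nonneg hz m w
      _ = ∑ L ∈ Finset.range L₀, ∑ w ∈ (Finset.range (N + 1)).biUnion
            (fun n => (sawWords n).filter (fun w => IsBridgeW w ∧ xEnd w = (L : ℤ))),
                (z ^ w.length * Real.exp (m * (xEnd w : ℝ))) :=
          Finset.sum_biUnion hdisj
      _ ≤ ∑ L ∈ Finset.range L₀, ∑ w ∈ (Finset.range (N + 1)).biUnion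
            (fun n => (sawWords n).filter (fun w => IsBridgeW w ∧ xEnd w = (L : ℤ))),
              criticalFugacity ^ w.length * Real.exp (m * L₀) :=
          Finset.sum_le_sum fun L hL => Finset.sum_le_sum fun w hw => hterm L hL w hw
      _ ≤ ∑ L ∈ Finset.range L₀, 1 * Real.exp (m * L₀) := by
          refine Finset.sum_le_sum fun L _ => ?_
          rw [← Finset.sum_mul]
          exact mul_le_mul_of_nonneg_right (StripMass.bridgeWordMass_le_one (L : ℤ) N)
            (Real.exp_nonneg _)
      _ = L₀ * Real.exp (m * L₀) := by simp
  -- the large spans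
  have hB := gfBr_nonneg hz N m
  have hlarge : (∑ w ∈ ((Finset.range (N + 1)).biUnion sawWords).filter (fun w => IsBridgeW w
      ∧ (L₀ : ℤ) ≤ xEnd w), z ^ w.length * Real.exp (m * (xEnd w : ℝ))) ≤ 1 / 2
      * (∑ w ∈ ((Finset.range (N + 1)).biUnion sawWords).filter (fun w => IsBridgeW w),
      z ^ w.length * Real.exp (m * (xEnd w : ℝ))) :=
    (gfBrGe_le hz N L₀).trans (mul_le_mul_of_nonneg_right hH hB)
  linarith

/-! ### Step 3: half-space words are controlled by long bridges -/

/-- **`H_N(z, L) e^{mL} ≤ B_N^{≥ L}(z, m) · χ_N(z)`** (`z, m ≥ 0`): cut a half-space word ending on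
`x = L` at a time where `x` is maximal (`exists_bridge_prefix_of_pos`); the head is a bridge of span
`≥ L`, the tail a self-avoiding word. [cite: MadrasSlade1993, §4.1, (4.1.17)–(4.1.20)] -/
theorem gfPos_mul_exp_le {z m : ℝ} (hz : 0 ≤ z) (hm : 0 ≤ m) (N L : ℕ) :
    (∑ w ∈ ((Finset.range (N + 1)).biUnion sawWords).filter
        (fun w => (∀ i, 1 ≤ i → i ≤ w.length → 0 < xAt w i) ∧ xEnd w = (L : ℤ)), z ^ w.length) * Real.exp (m * L)
        ≤ (∑ w ∈ ((Finset.range (N + 1)).biUnion sawWords).filter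
        (fun w => IsBridgeW w ∧ (L : ℤ) ≤ xEnd w), z ^ w.length * Real.exp (m * (xEnd w : ℝ)))
        * (∑ w ∈ ((Finset.range (N + 1)).biUnion sawWords), z ^ w.length) := by
  rw [Finset.sum_mul]
  refine sum_le_mul_sum_of_split (fun p _ => tiltWt_nonneg hz m p) (fun q _ => pow_nonneg hz _) ?_
  intro u hu
  obtain ⟨hW, hpos, huL⟩ := Finset.mem_filter.1 hu
  obtain ⟨hlen, hsaw⟩ := mem_Wset.1 hW
  obtain ⟨p, q, rfl, hp, hpL⟩ := exists_bridge_prefix_of_pos hpos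
  rw [List.length_append] at hlen
  have hLp : (L : ℤ) ≤ xEnd p := huL ▸ hpL
  refine ⟨p, Finset.mem_filter.2 ⟨mem_Wset.2 ⟨by omega, ?_⟩, hp, hLp⟩, q,
    mem_Wset.2 ⟨by omega, ?_⟩, rfl, ?_⟩
  · have := hsaw.take p.length
    rwa [List.take_left] at this
  · have := hsaw.drop p.length
    rwa [List.drop_left] at this
  · have hLp' : (L : ℝ) ≤ (xEnd p : ℝ) := by exact_mod_cast hLp
    have h1 : Real.exp (m * L) ≤ Real.exp (m * (xEnd p : ℝ)) :=
      Real.exp_le_exp.2 (mul_le_mul_of_nonneg_left hLp' hm)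
    have h0 : 0 ≤ z ^ p.length * z ^ q.length := by positivity
    calc z ^ (p ++ q).length * Real.exp (m * L)
        = z ^ p.length * z ^ q.length * Real.exp (m * L) := by rw [List.length_append, pow_add]
      _ ≤ z ^ p.length * z ^ q.length * Real.exp (m * (xEnd p : ℝ)) :=
          mul_le_mul_of_nonneg_left h1 h0
      _ = (z ^ p.length * Real.exp (m * (xEnd p : ℝ))) * z ^ q.length := by ring

/-- **Span tails.** If `B_N(z, m) ≤ B` for all `N` (`z ≥ 0`), then for every `η > 0` there is `L₀ ≥ 1`
with `B_N^{≥ L₀}(z, m) ≤ η` for all `N` (the tail of a convergent monotone double limit; bridge words of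
length `≤ N₁` have span `≤ N₁`). [folklore] -/
theorem exists_gfBrGe_le {z m B η : ℝ} (hz : 0 ≤ z)
    (hB : ∀ N, (∑ w ∈ ((Finset.range (N + 1)).biUnion sawWords).filter (fun w => IsBridgeW w),
    z ^ w.length * Real.exp (m * (xEnd w : ℝ))) ≤ B) (hη : 0 < η) :
    ∃ L₀ : ℕ, 1 ≤ L₀ ∧ ∀ N,
        (∑ w ∈ ((Finset.range (N + 1)).biUnion sawWords).filter
        (fun w => IsBridgeW w ∧ (L₀ : ℤ) ≤ xEnd w), z ^ w.length * Real.exp (m * (xEnd w : ℝ))) ≤ η := by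
  have hbdd : BddAbove (Set.range fun N =>
      (∑ w ∈ ((Finset.range (N + 1)).biUnion sawWords).filter (fun w => IsBridgeW w),
      z ^ w.length * Real.exp (m * (xEnd w : ℝ)))) := ⟨B, by rintro _ ⟨N, rfl⟩; exact hB N⟩
  set F := sSup (Set.range fun N =>
      (∑ w ∈ ((Finset.range (N + 1)).biUnion sawWords).filter (fun w => IsBridgeW w),
      z ^ w.length * Real.exp (m * (xEnd w : ℝ)))) with hF
  have hle : ∀ N, (∑ w ∈ ((Finset.range (N + 1)).biUnion sawWords).filter (fun w => IsBridgeW w),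
      z ^ w.length * Real.exp (m * (xEnd w : ℝ))) ≤ F := fun N => le_csSup hbdd ⟨N, rfl⟩
  obtain ⟨_, ⟨N₁, rfl⟩, hN₁⟩ :=
    exists_lt_of_lt_csSup (Set.range_nonempty fun N =>
        (∑ w ∈ ((Finset.range (N + 1)).biUnion sawWords).filter (fun w => IsBridgeW w),
        z ^ w.length * Real.exp (m * (xEnd w : ℝ)))) (show F - η < F by linarith)
  refine ⟨N₁ + 1, by omega, fun N => ?_⟩
  -- the complementary part `B^{< L₀}`
  set lt : ℕ → ℝ := fun M => ∑ w ∈ ((Finset.range (M + 1)).biUnion sawWords).filter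
    (fun w => IsBridgeW w ∧ ¬ (((N₁ + 1 : ℕ) : ℤ) ≤ xEnd w)),
        (z ^ w.length * Real.exp (m * (xEnd w : ℝ))) with hlt
  have hsplit : ∀ M, (∑ w ∈ ((Finset.range (M + 1)).biUnion sawWords).filter (fun w => IsBridgeW w),
      z ^ w.length * Real.exp (m * (xEnd w : ℝ))) = lt M
      + (∑ w ∈ ((Finset.range (M + 1)).biUnion sawWords).filter (fun w => IsBridgeW w
      ∧ (((N₁ + 1 : ℕ) : ℤ) : ℤ) ≤ xEnd w), z ^ w.length * Real.exp (m * (xEnd w : ℝ))) :=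
      fun M => by
    simp only [hlt]
    rw [← Finset.sum_filter_add_sum_filter_not
        (((Finset.range (M + 1)).biUnion sawWords).filter fun w => IsBridgeW w)
      (fun w => ((N₁ + 1 : ℕ) : ℤ) ≤ xEnd w), Finset.filter_filter, Finset.filter_filter, add_comm]
  have hlt_mono : lt N₁ ≤ lt (max N N₁) :=
    Finset.sum_le_sum_of_subset_of_nonneg
        (Finset.filter_subset_filter _ (Wset_mono (le_max_right _ _)))
      fun w _ _ => tiltWt_nonneg hz m w
  have hlt_N₁ : lt N₁ =
      (∑ w ∈ ((Finset.range (N₁ + 1)).biUnion sawWords).filter (fun w => IsBridgeW w),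
      z ^ w.length * Real.exp (m * (xEnd w : ℝ))) := by
    simp only [hlt]
    refine Finset.sum_congr (Finset.filter_congr fun w hw => ?_) fun _ _ => rfl
    have h1 := xEnd_le_length w
    have h2 := (mem_Wset.1 hw).1
    constructor
    · exact fun h => h.1
    · intro h
      refine ⟨h, ?_⟩
      push_cast
      omega
  calc (∑ w ∈ ((Finset.range (N + 1)).biUnion sawWords).filter (fun w => IsBridgeW w
      ∧ (((N₁ + 1 : ℕ) : ℤ) : ℤ) ≤ xEnd w), z ^ w.length * Real.exp (m * (xEnd w : ℝ)))
      ≤ (∑ w ∈ ((Finset.range ((max N N₁) + 1)).biUnion sawWords).filter (fun w => IsBridgeW w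
      ∧ (((N₁ + 1 : ℕ) : ℤ) : ℤ) ≤ xEnd w), z ^ w.length * Real.exp (m * (xEnd w : ℝ))) :=
        gfBrGe_mono_N (le_max_left _ _) hz m _
    _ = (∑ w ∈ ((Finset.range ((max N N₁) + 1)).biUnion sawWords).filter (fun w => IsBridgeW w),
        z ^ w.length * Real.exp (m * (xEnd w : ℝ))) - lt (max N N₁) :=
        by linarith [hsplit (max N N₁)]
    _ ≤ F - lt N₁ := by linarith [hle (max N N₁)]
    _ = F - (∑ w ∈ ((Finset.range (N₁ + 1)).biUnion sawWords).filter (fun w => IsBridgeW w),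
        z ^ w.length * Real.exp (m * (xEnd w : ℝ))) := by rw [hlt_N₁]
    _ ≤ η := by linarith

/-! ### Registered sub-goal of part II -/

/-- **Scale-`L₀` renewal** (the registered sub-goal `kestenTilt_scaleRenewal` of the crux item, part II of
the stub `stub_kestenTilt`; `gfBr_le_of_gfPos_le` restated in closed form): for `0 ≤ z ≤ x_c`, `m ≥ 0`, if
`H_N(z, L₀) e^{mL₀} ≤ 1/2` then `B_N(z, m) ≤ 2 L₀ e^{mL₀}`. [cite: MadrasSlade1993, §4.1, (4.1.12)–(4.1.13)] -/
theorem kestenTilt_scaleRenewal : ∀ (z m : ℝ) (N L₀ : ℕ), 0 ≤ z → z ≤ criticalFugacity → 0 ≤ m →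
    (∑ w ∈ ((Finset.range (N + 1)).biUnion sawWords).filter
        (fun w => (∀ i, 1 ≤ i → i ≤ w.length → 0 < xAt w i) ∧ xEnd w = (L₀ : ℤ)), z ^ w.length)
        * Real.exp (m * L₀) ≤ 1 / 2 →
    (∑ w ∈ ((Finset.range (N + 1)).biUnion sawWords).filter (fun w => IsBridgeW w),
        z ^ w.length * Real.exp (m * (xEnd w : ℝ))) ≤ 2 * (L₀ * Real.exp (m * L₀)) :=
  fun _ _ _ _ hz hzc hm hH => gfBr_le_of_gfPos_le hz hzc hm hH

end KestenTilt

end Summit.CriticalPhenomena.SAWScalingLimit.Theorems.TubeLowerBound.SubcriticalRenewalFloor
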